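import Literature.AlgebraicGeometry.Morphisms.CechUnitCocycleDualNumbers
import HarnessLib

/-!
# The abstract induction: a lift model with injective Kodaira–Spencer maps and `h¹ ≤ dim` has graph points at every level

[MumfordAV1970] §13, proof of the Theorem pp. 125–130, AV-free skeleton: `LiftModel` (one chart ring) and `LiftModel₂`
(level-indexed Artinian chart rings `B n` with reductions `β n`): a tower of augmented small extensions `R (n+1) → R n`,
a graph predicate on chart points, a base point, lifts of chart points, and the COCYCLE MODEL of the graph condition;
`LiftModel.exists_graph` / `LiftModel₂.exists_graph`: if every Kodaira–Spencer map `KS : DerAt (ev (n+1)) → Ȟ¹(𝒰, 𝒪_X)` is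
injective and `dim Ȟ¹ ≤ dim DerAt`, there is a graph point at every level (surjectivity of `KS` by dimension count, then
correct the lift by `addDer`).
HC_CM is proved only modulo the 7 printed citations until rung 0 closes.

## References
* [GortzWedhorn2023] U. Görtz, T. Wedhorn, *Algebraic Geometry II*, Lemma 26.15, Prop. 27.122 (`Lie(Pic_{X/S}) ≅ R¹f_*𝒪_X` via `U[ε]`).
* [MumfordAV1970] D. Mumford, *Abelian Varieties*, §13 (proof of the Thm. pp. 125–130).
* The Stacks Project, Tag 08SP (deformations of invertible modules), Tag 01ED (Čech cohomology).
-/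

noncomputable section

universe u v

open TensorProduct CategoryTheory AlgebraicGeometry
open Literature.RingTheory.Flat Literature.RingTheory.Flat.IsSmallExtension

namespace Literature.AlgebraicGeometry.Morphisms

namespace CechUnitCocycle

variable {A : Type u} [CommRing A] {X : Scheme.{u}} (f : X ⟶ Spec (.of A)) {ι : Type v} (U : ι → X.Opens)

/-! ## §8 THE ABSTRACT INDUCTION: a lift model with injective Kodaira–Spencer map and `h¹ ≤ dim T_{y₀}` has
graph points at every level -/

section Induction

variable {f} {U}
variable {B : Type u} [CommRing B] [Algebra A B]

/-- **A LIFT MODEL** for transition data `p` over a chart ring `B` with base point `ev : B → A`: a tower of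
augmented small extensions `R (n+1) → R n` (for M13: `R n = 𝒪_{T,t}/𝔪^{n+1}`), a predicate `Graph n φ` on chart
points `φ : B → R n` (for M13: «`(1 × g_φ)^*𝒫 ≅ ℒ|_{A₀ × Spec R_n}`»), all graph points lying over `ev`, a graph
point at level `0`, lifts of chart points (smoothness of the chart), and THE COCYCLE MODEL OF THE GRAPH CONDITION
one level up: over a graph point `φ`, for each lift `φ'` there is a unit cocycle `ℓ'` (the transition cocycle of
`ℒ|_{A₀ × Spec R_{n+1}}` in frames normalised against `p.map φ'`) with the same reduction as `p.map φ'`, such that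
ANY lift `φ''` whose cocycle `p.map φ''` is related to `ℓ'` by a unit `0`-cochain reducing to `1` is a graph point.
Pure bookkeeping structure (no axioms); instances for M13 are produced by N3c. [cite: MumfordAV1970, §13 (proof of the Thm. pp. 125–130)] -/
structure LiftModel (p : UCocycle f U B) (ev : B →ₐ[A] A) where
  /-- the levels `R n` -/
  R : ℕ → Type u
  /-- ring structures -/
  commRing : ∀ n, CommRing (R n)
  /-- algebra structures -/
  algebra : ∀ n, Algebra A (R n)
  /-- the transition maps `R (n+1) → R n` -/
  π : ∀ n, R (n + 1) →ₐ[A] R n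
  /-- the augmentations `R n → A` -/
  ρ : ∀ n, R n →ₐ[A] A
  /-- the kernels -/
  I : ∀ n, Ideal (R (n + 1))
  /-- their ranks -/
  d : ℕ → ℕ
  /-- their frames -/
  e : ∀ n, (Fin (d n) → A) ≃ₗ[A] I n
  /-- each step is an augmented small extension -/
  small : ∀ n, IsSmallExtension (π n) (ρ (n + 1)) (I n) (e n)
  /-- compatibility of the augmentations -/
  hρ : ∀ n, (ρ n).comp (π n) = ρ (n + 1)
  /-- the graph condition on chart points -/
  Graph : ∀ n, (B →ₐ[A] R n) → Prop
  /-- graph points lie over the base point -/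
  graph_ev : ∀ n (φ : B →ₐ[A] R n), Graph n φ → (ρ n).comp φ = ev
  /-- a graph point at level `0` -/
  base : ∃ φ₀ : B →ₐ[A] R 0, Graph 0 φ₀
  /-- chart points lift (the chart is smooth) -/
  lift : ∀ n (φ : B →ₐ[A] R n), ∃ φ' : B →ₐ[A] R (n + 1), (π n).comp φ' = φ
  /-- the cocycle model of the graph condition one level up -/
  model : ∀ n (φ : B →ₐ[A] R n), Graph n φ → ∀ φ' : B →ₐ[A] R (n + 1), (π n).comp φ' = φ →
    ∃ ℓ' : UCocycle f U (R (n + 1)), SameRed (p.map φ') ℓ' (π n) ∧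
      ∀ (φ'' : B →ₐ[A] R (n + 1)) (h : UCochain0 f U (R (n + 1))), (π n).comp φ'' = φ →
        (∀ i, coef f (π n) (U i) (h i : Sections f (U i) ⊗[A] R (n + 1)) = 1) →
        Rel (p.map φ'') ℓ' (fun i => (h i : Sections f (U i) ⊗[A] R (n + 1))) → Graph (n + 1) φ''

attribute [instance] LiftModel.commRing LiftModel.algebra

end Induction

section InductionField

variable {K : Type u} [Field K] {X : Scheme.{u}} {f : X ⟶ Spec (.of K)} {ι : Type v} {U : ι → X.Opens}
variable {B : Type u} [CommRing B] [Algebra K B] {p : UCocycle f U B} {ev : B →ₐ[K] K}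

/-- **THE ABSTRACT EXISTENCE OF INFINITESIMAL LIFTS.** For a lift model over a field `K` whose Kodaira–Spencer map
`KS : Der_K(B, K_{ev}) → Ȟ¹(𝒰, 𝒪_X)` is INJECTIVE ((3d)) and with `dim Ȟ¹(𝒰, 𝒪_X) ≤ dim Der_K(B, K_{ev})`
((3e) `h^{0,1} ≤ g` + `dim T_{y₀}Â = g`), there is a graph point at every level: given a graph point `φ` at level
`n`, lift it to `φ'`, form the difference class `c ∈ Ȟ¹(𝒰,𝒪)^d` of the cocycle model against `p.map φ'`, solve
`KS(D_ℓ) = c_ℓ` (KS is then BIJECTIVE), and replace `φ'` by `φ' + e(D)`: the new difference class is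
`−KS(D) + c = 0`, so the cocycles are related by a `0`-cochain reducing to `1` and `φ' + e(D)` is a graph point.
[cite: MumfordAV1970, §13 (proof of the Thm. pp. 125–130)] [cite: GortzWedhorn2023, Lemma 26.15 and Prop. 27.122] -/
theorem LiftModel.exists_graph (M : LiftModel p ev) (hKS : Function.Injective (ksLinear p ev))
    [FiniteDimensional K (DerAt ev)] [Module.Finite K (CechH1 f U)]
    (hdim : Module.finrank K (CechH1 f U) ≤ Module.finrank K (DerAt ev)) (n : ℕ) :
    ∃ φ : B →ₐ[K] M.R n, M.Graph n φ := by
  -- `KS` is bijective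
  have hsurj : Function.Surjective (ksLinear p ev) := by
    have hr : Module.finrank K (LinearMap.range (ksLinear p ev)) = Module.finrank K (DerAt ev) :=
      LinearMap.finrank_range_of_inj hKS
    have hle : Module.finrank K (LinearMap.range (ksLinear p ev)) ≤ Module.finrank K (CechH1 f U) :=
      Submodule.finrank_le _
    have htop : LinearMap.range (ksLinear p ev) = ⊤ :=
      Submodule.eq_top_of_finrank_eq (le_antisymm hle (hdim.trans hr.symm.le))
    exact LinearMap.range_eq_top.1 htop
  induction n with
  | zero => exact M.base
  | succ n ih =>
    obtain ⟨φ, hφ⟩ := ih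
    obtain ⟨φ', hφ'⟩ := M.lift n φ
    obtain ⟨ℓ', hred, hmodel⟩ := M.model n φ hφ φ' hφ'
    have hev : (M.ρ (n + 1)).comp φ' = ev := by rw [← M.hρ n, AlgHom.comp_assoc, hφ', M.graph_ev n φ hφ]
    -- the difference class of the model against `p.map φ'` and the derivations killing it
    set c : Fin (M.d n) → CechH1 f U := diffClass (M.small n) (M.hρ n) (p.map φ') ℓ' hred with hc
    have hD : ∀ ℓ, ∃ D : DerAt ((M.ρ (n + 1)).comp φ'), ksLinear p ((M.ρ (n + 1)).comp φ') D = c ℓ := by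
      intro ℓ; rw [hev]; exact hsurj (c ℓ)
    choose D hD using hD
    -- the corrected lift
    let φ'' : B →ₐ[K] M.R (n + 1) := addDer (M.small n) (M.hρ n) φ' D
    have hφ'' : (M.π n).comp φ'' = (M.π n).comp φ' := comp_addDer (M.small n) (M.hρ n) φ' D
    have hredp : SameRed (p.map φ'') (p.map φ') (M.π n) := sameRed_map_map p φ'' φ' hφ''.symm
    -- its difference class against `ℓ'` vanishes
    have hzero : ∀ ℓ, diffClass (M.small n) (M.hρ n) (p.map φ'') ℓ' (hredp.trans hred) ℓ = 0 := by
      intro ℓ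
      rw [diffClass_trans (M.small n) (M.hρ n) (p.map φ'') (p.map φ') ℓ' hredp hred ℓ]
      have h1 : diffClass (M.small n) (M.hρ n) (p.map φ') (p.map φ'') (sameRed_map_map p φ' φ'' hφ'') ℓ = c ℓ := by
        rw [diffClass_map_map_eq_ksLinear (M.small n) (M.hρ n) p φ' φ'' hφ'' ℓ, ← hD ℓ]
        congr 2
        exact liftDiffCoord_addDer (M.small n) (M.hρ n) φ' D ℓ
      have h2 : diffClass (M.small n) (M.hρ n) (p.map φ'') (p.map φ') hredp ℓ = -c ℓ := by
        rw [← h1, ← diffClass_symm (M.small n) (M.hρ n) (p.map φ') (p.map φ'') (sameRed_map_map p φ' φ'' hφ'') ℓ]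
      rw [h2, ← hc, neg_add_cancel]
    obtain ⟨h, h1, hrel⟩ := exists_rel_of_diffClass_eq_zero (M.small n) (M.hρ n) (p.map φ'') ℓ' (hredp.trans hred) hzero
    exact ⟨φ'', hmodel φ'' h (hφ''.trans hφ') h1 hrel⟩

end InductionField

section V2

variable {A : Type u} [CommRing A] {X : Scheme.{u}} {f : X ⟶ Spec (.of A)} {ι : Type v} {U : ι → X.Opens}

variable (f U) in
/-- **A LIFT MODEL WITH LEVEL-INDEXED (ARTINIAN) CHARTS**: as `LiftModel`, but the chart ring `B n`
(«`𝒪_{Â,y₀}/𝔪^{n+1}`»), its base point `ev n` and the transition data `p n` of the chart bundle vary with the level,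
with reductions `β n : B (n+1) → B n`; chart points at level `n` are `φ : B n → R n`, lifts are `φ' : B (n+1) → R (n+1)`
with `π n ∘ φ' = φ ∘ β n`. Plumbing structure, no axioms. [cite: MumfordAV1970, §13 (proof of the Thm. pp. 125–130)] -/
structure LiftModel₂ where
  /-- levels -/
  R : ℕ → Type u
  /-- ring structures -/
  commRing : ∀ n, CommRing (R n)
  /-- algebra structures -/
  algebra : ∀ n, Algebra A (R n)
  /-- transitions -/
  π : ∀ n, R (n + 1) →ₐ[A] R n
  /-- augmentations -/
  ρ : ∀ n, R n →ₐ[A] A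
  /-- kernels -/
  I : ∀ n, Ideal (R (n + 1))
  /-- ranks -/
  d : ℕ → ℕ
  /-- frames of the kernels -/
  e : ∀ n, (Fin (d n) → A) ≃ₗ[A] I n
  /-- small extensions -/
  small : ∀ n, IsSmallExtension (π n) (ρ (n + 1)) (I n) (e n)
  /-- compatibility of augmentations -/
  hρ : ∀ n, (ρ n).comp (π n) = ρ (n + 1)
  /-- chart rings -/
  B : ℕ → Type u
  /-- ring structures -/
  commRingB : ∀ n, CommRing (B n)
  /-- algebra structures -/
  algebraB : ∀ n, Algebra A (B n)
  /-- chart reductions -/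
  β : ∀ n, B (n + 1) →ₐ[A] B n
  /-- base points of the charts -/
  ev : ∀ n, B n →ₐ[A] A
  /-- compatibility of base points -/
  hev : ∀ n, (ev n).comp (β n) = ev (n + 1)
  /-- transition data of the chart bundle at each level -/
  p : ∀ n, UCocycle f U (B n)
  /-- the graph predicate on chart points -/
  Graph : ∀ n, (B n →ₐ[A] R n) → Prop
  /-- graph points lie over the base point -/
  graph_ev : ∀ n (φ : B n →ₐ[A] R n), Graph n φ → (ρ n).comp φ = ev n
  /-- a graph point at level `0` -/
  base : ∃ φ₀ : B 0 →ₐ[A] R 0, Graph 0 φ₀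
  /-- graph points lift to chart points one level up -/
  lift : ∀ n (φ : B n →ₐ[A] R n), Graph n φ → ∃ φ' : B (n + 1) →ₐ[A] R (n + 1), (π n).comp φ' = φ.comp (β n)
  /-- the cocycle model of the graph condition one level up -/
  model : ∀ n (φ : B n →ₐ[A] R n), Graph n φ → ∀ φ' : B (n + 1) →ₐ[A] R (n + 1), (π n).comp φ' = φ.comp (β n) →
    ∃ ℓ' : UCocycle f U (R (n + 1)), SameRed ((p (n + 1)).map φ') ℓ' (π n) ∧
      ∀ (φ'' : B (n + 1) →ₐ[A] R (n + 1)) (h : UCochain0 f U (R (n + 1))), (π n).comp φ'' = φ.comp (β n) →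
        (∀ i, coef f (π n) (U i) (h i : Sections f (U i) ⊗[A] R (n + 1)) = 1) →
        Rel ((p (n + 1)).map φ'') ℓ' (fun i => (h i : Sections f (U i) ⊗[A] R (n + 1))) → Graph (n + 1) φ''

attribute [instance] LiftModel₂.commRing LiftModel₂.algebra LiftModel₂.commRingB LiftModel₂.algebraB

end V2

section V2Field

variable {K : Type u} [Field K] {X : Scheme.{u}} {f : X ⟶ Spec (.of K)} {ι : Type v} {U : ι → X.Opens}

/-- **THE ABSTRACT EXISTENCE OF INFINITESIMAL LIFTS (level-indexed charts).** [cite: MumfordAV1970, §13 (proof of the Thm. pp. 125–130)]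
[cite: GortzWedhorn2023, Lemma 26.15 and Prop. 27.122] -/
theorem LiftModel₂.exists_graph (M : LiftModel₂ f U) (hKS : ∀ n, Function.Injective (ksLinear (M.p (n + 1)) (M.ev (n + 1))))
    [∀ n, FiniteDimensional K (DerAt (M.ev (n + 1)))] [Module.Finite K (CechH1 f U)]
    (hdim : ∀ n, Module.finrank K (CechH1 f U) ≤ Module.finrank K (DerAt (M.ev (n + 1)))) (n : ℕ) :
    ∃ φ : M.B n →ₐ[K] M.R n, M.Graph n φ := by
  have hsurj : ∀ n, Function.Surjective (ksLinear (M.p (n + 1)) (M.ev (n + 1))) := fun n => by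
    have hr : Module.finrank K (LinearMap.range (ksLinear (M.p (n + 1)) (M.ev (n + 1)))) =
        Module.finrank K (DerAt (M.ev (n + 1))) := LinearMap.finrank_range_of_inj (hKS n)
    have hle : Module.finrank K (LinearMap.range (ksLinear (M.p (n + 1)) (M.ev (n + 1)))) ≤
        Module.finrank K (CechH1 f U) := Submodule.finrank_le _
    exact LinearMap.range_eq_top.1 (Submodule.eq_top_of_finrank_eq (le_antisymm hle ((hdim n).trans hr.symm.le)))
  induction n with
  | zero => exact M.base
  | succ n ih =>
    obtain ⟨φ, hφ⟩ := ih
    obtain ⟨φ', hφ'⟩ := M.lift n φ hφ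
    obtain ⟨ℓ', hred, hmodel⟩ := M.model n φ hφ φ' hφ'
    have hev : (M.ρ (n + 1)).comp φ' = M.ev (n + 1) := by
      rw [← M.hρ n, AlgHom.comp_assoc, hφ', ← AlgHom.comp_assoc, M.graph_ev n φ hφ, M.hev]
    set c : Fin (M.d n) → CechH1 f U := diffClass (M.small n) (M.hρ n) ((M.p (n + 1)).map φ') ℓ' hred with hc
    have hD : ∀ ℓ, ∃ D : DerAt ((M.ρ (n + 1)).comp φ'), ksLinear (M.p (n + 1)) ((M.ρ (n + 1)).comp φ') D = c ℓ := by
      intro ℓ; rw [hev]; exact hsurj n (c ℓ)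
    choose D hD using hD
    let φ'' : M.B (n + 1) →ₐ[K] M.R (n + 1) := addDer (M.small n) (M.hρ n) φ' D
    have hφ'' : (M.π n).comp φ'' = (M.π n).comp φ' := comp_addDer (M.small n) (M.hρ n) φ' D
    have hredp : SameRed ((M.p (n + 1)).map φ'') ((M.p (n + 1)).map φ') (M.π n) :=
      sameRed_map_map (M.p (n + 1)) φ'' φ' hφ''.symm
    have hzero : ∀ ℓ, diffClass (M.small n) (M.hρ n) ((M.p (n + 1)).map φ'') ℓ' (hredp.trans hred) ℓ = 0 := by
      intro ℓ
      rw [diffClass_trans (M.small n) (M.hρ n) ((M.p (n + 1)).map φ'') ((M.p (n + 1)).map φ') ℓ' hredp hred ℓ]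
      have h1 : diffClass (M.small n) (M.hρ n) ((M.p (n + 1)).map φ') ((M.p (n + 1)).map φ'')
          (sameRed_map_map (M.p (n + 1)) φ' φ'' hφ'') ℓ = c ℓ := by
        rw [diffClass_map_map_eq_ksLinear (M.small n) (M.hρ n) (M.p (n + 1)) φ' φ'' hφ'' ℓ, ← hD ℓ]
        congr 2
        exact liftDiffCoord_addDer (M.small n) (M.hρ n) φ' D ℓ
      have h2 : diffClass (M.small n) (M.hρ n) ((M.p (n + 1)).map φ'') ((M.p (n + 1)).map φ') hredp ℓ = -c ℓ := by
        rw [← h1, ← diffClass_symm (M.small n) (M.hρ n) ((M.p (n + 1)).map φ') ((M.p (n + 1)).map φ'')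
          (sameRed_map_map (M.p (n + 1)) φ' φ'' hφ'') ℓ]
      rw [h2, ← hc, neg_add_cancel]
    obtain ⟨h, h1, hrel⟩ := exists_rel_of_diffClass_eq_zero (M.small n) (M.hρ n) ((M.p (n + 1)).map φ'') ℓ'
      (hredp.trans hred) hzero
    exact ⟨φ'', hmodel φ'' h (hφ''.trans hφ') h1 hrel⟩

end V2Field

end CechUnitCocycle

end Literature.AlgebraicGeometry.Morphisms

end
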